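import Mathlib.Analysis.Complex.CauchyIntegral
import Mathlib.MeasureTheory.Integral.IntervalIntegral.Basic
import Mathlib.Topology.UniformSpace.HeineCantor
import Mathlib.Topology.MetricSpace.Thickening
import Mathlib.Analysis.Normed.Module.Ball.Pointwise
import HarnessLib

/-!
# Tools for Voronin's universality theorem on discs, I: suprema on a disc from mean squares on a circle

Topic `Literature/NumberTheory/LFunctions`. Everything in this file is PROVED. It supplies the
device by which the proof of Voronin's universality theorem (Steuding, *Value-Distribution of
L-Functions*, §1.3, (1.21): "It follows from Cauchy's formula that …"; Bayart–Matheron, *Dynamics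
of Linear Operators*, Lemma 11.3 and Exercise 11.1 for Bergman norms) passes from mean-square
estimates to uniform estimates on a smaller disc:

* `sq_integral_le_mul_integral_sq` — Cauchy–Schwarz for interval integrals,
  `(∫ₐᵇ f)² ≤ (b − a) ∫ₐᵇ f²`;
* `norm_sq_le_mul_integral_norm_sq_circle` — for `h` holomorphic in `|z − c| < ρ'` and continuous
  up to the circle, and `|w − c| ≤ ρ < ρ'`,
  `|h(w)|² ≤ ρ'² / (2π (ρ' − ρ)²) · ∫₀^{2π} |h(c + ρ' e^{iθ})|² dθ`
  (Cauchy's integral formula on the circle `|z − c| = ρ'` and Cauchy–Schwarz);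
* small generic lemmas of the final bookkeeping: a zero-free continuous function on a closed disc
  is zero-free on a larger one (`exists_gt_forall_closedBall_ne_zero`), a continuity radius uniform
  in a compact parameter (`exists_radius_forall_norm_sub_lt`), the lower bound
  `meas {t ∈ [0,T] : good} ≥ ∫₀ᵀ g` for a continuous `g ≤ 1` positive only at good points
  (`ofReal_integral_le_volume`), and the real-number bookkeeping of the time integrals
  (`integral_bookkeeping`).

## References

* [Steuding2007] J. Steuding, *Value-Distribution of L-Functions*, LNM 1877, §1.3 (1.21).
* [BayartMatheron2009] F. Bayart, É. Matheron, *Dynamics of Linear Operators*, Lemma 11.3,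
  Exercise 11.1.
-/

noncomputable section

open Complex Metric MeasureTheory Set intervalIntegral Real

namespace Literature.NumberTheory.LFunctions

namespace VoroninTools

/-- **Cauchy–Schwarz for interval integrals:** for `a ≤ b` and `f`, `f²` integrable on `[a, b]`,
`(∫ₐᵇ f)² ≤ (b − a) ∫ₐᵇ f²` (expand `0 ≤ ∫ₐᵇ (f − m)²` with `m` the mean of `f`). [folklore] -/
theorem sq_integral_le_mul_integral_sq {f : ℝ → ℝ} {a b : ℝ} (hab : a ≤ b)
    (hf : IntervalIntegrable f volume a b)
    (hf2 : IntervalIntegrable (fun x ↦ f x ^ 2) volume a b) :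
    (∫ x in a..b, f x) ^ 2 ≤ (b - a) * ∫ x in a..b, f x ^ 2 := by
  rcases eq_or_lt_of_le hab with rfl | hab'
  · simp
  have hba : 0 < b - a := sub_pos.2 hab'
  set J := ∫ x in a..b, f x with hJ
  set m : ℝ := J / (b - a) with hm
  -- `0 ≤ ∫ (f - m)² = ∫ f² - 2 m J + m² (b - a)`
  have hint : IntervalIntegrable (fun x ↦ (f x - m) ^ 2) volume a b := by
    have e : (fun x ↦ (f x - m) ^ 2) = fun x ↦ f x ^ 2 - (2 * m) * f x + m ^ 2 := by
      funext x; ring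
    rw [e]
    exact (hf2.sub (hf.const_mul _)).add intervalIntegrable_const
  have h0 : 0 ≤ ∫ x in a..b, (f x - m) ^ 2 :=
    intervalIntegral.integral_nonneg hab fun x _ ↦ sq_nonneg _
  have hexp : ∫ x in a..b, (f x - m) ^ 2 =
      (∫ x in a..b, f x ^ 2) - 2 * m * J + m ^ 2 * (b - a) := by
    have e : (fun x ↦ (f x - m) ^ 2) = fun x ↦ (f x ^ 2 - (2 * m) * f x) + m ^ 2 := by
      funext x; ring
    rw [e, intervalIntegral.integral_add (hf2.sub (hf.const_mul _)) intervalIntegrable_const,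
      intervalIntegral.integral_sub hf2 (hf.const_mul _), intervalIntegral.integral_const_mul,
      intervalIntegral.integral_const, smul_eq_mul]
    ring
  rw [hexp] at h0
  have hmJ : 2 * m * J - m ^ 2 * (b - a) = J ^ 2 / (b - a) := by
    rw [hm]; field_simp; ring
  have h1 : J ^ 2 / (b - a) ≤ ∫ x in a..b, f x ^ 2 := by linarith
  rwa [div_le_iff₀ hba, mul_comm] at h1

/-- The Cauchy kernel on the circle `|z − c| = ρ'` seen from `|w − c| ≤ ρ < ρ'` is bounded by
`1/(ρ' − ρ)`. [folklore] -/
theorem norm_inv_circleMap_sub_le {c w : ℂ} {ρ ρ' : ℝ} (hρρ' : ρ < ρ') (hw : w ∈ closedBall c ρ)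
    (θ : ℝ) : ‖(circleMap c ρ' θ - w)⁻¹‖ ≤ (ρ' - ρ)⁻¹ := by
  have hρ' : 0 < ρ' - ρ := sub_pos.2 hρρ'
  have hdist : ρ' - ρ ≤ ‖circleMap c ρ' θ - w‖ := by
    have h1 : ‖circleMap c ρ' θ - c‖ = |ρ'| := by
      simpa only [mem_sphere, dist_eq_norm] using circleMap_mem_sphere' c ρ' θ
    have h2 : ‖w - c‖ ≤ ρ := by rwa [mem_closedBall, dist_eq_norm] at hw
    have h3 : ‖circleMap c ρ' θ - c‖ ≤ ‖circleMap c ρ' θ - w‖ + ‖w - c‖ := by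
      calc ‖circleMap c ρ' θ - c‖ = ‖(circleMap c ρ' θ - w) + (w - c)‖ := by ring_nf
        _ ≤ _ := norm_add_le _ _
    rw [h1] at h3
    have : ρ' ≤ |ρ'| := le_abs_self ρ'
    linarith
  rw [norm_inv]
  exact inv_anti₀ hρ' hdist

/-- **Supremum on a disc from the mean square on a larger circle.** If `h` is holomorphic on
`|z − c| < ρ'` and continuous on `|z − c| ≤ ρ'`, then for `|w − c| ≤ ρ < ρ'`,
`|h(w)|² ≤ ρ'²/(2π(ρ'−ρ)²) ∫₀^{2π} |h(c + ρ'e^{iθ})|² dθ` (Cauchy's formula and Cauchy–Schwarz).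
[cite: Steuding2007, §1.3 (1.21)] -/
theorem norm_sq_le_mul_integral_norm_sq_circle {h : ℂ → ℂ} {c : ℂ} {ρ ρ' : ℝ} (hρ : 0 ≤ ρ)
    (hρρ' : ρ < ρ') (hd : DiffContOnCl ℂ h (ball c ρ')) {w : ℂ} (hw : w ∈ closedBall c ρ) :
    ‖h w‖ ^ 2 ≤ ρ' ^ 2 / (2 * π * (ρ' - ρ) ^ 2) *
      ∫ θ in (0 : ℝ)..2 * π, ‖h (circleMap c ρ' θ)‖ ^ 2 := by
  have hρ'0 : 0 < ρ' := lt_of_le_of_lt hρ hρρ'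
  have hρ'ρ : 0 < ρ' - ρ := sub_pos.2 hρρ'
  have hwb : w ∈ ball c ρ' := closedBall_subset_ball hρρ' hw
  -- Cauchy's formula
  have hC := hd.two_pi_i_inv_smul_circleIntegral_sub_inv_smul hwb
  -- continuity of `θ ↦ h (circleMap c ρ' θ)`
  have hcont : Continuous fun θ : ℝ ↦ h (circleMap c ρ' θ) := by
    have h1 : ContinuousOn h (closedBall c ρ') := by
      simpa only [closure_ball c hρ'0.ne'] using hd.continuousOn
    exact h1.comp_continuous (continuous_circleMap c ρ') fun θ ↦
      sphere_subset_closedBall (circleMap_mem_sphere c hρ'0.le θ)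
  set F : ℝ → ℝ := fun θ ↦ ‖h (circleMap c ρ' θ)‖ with hF
  have hFc : Continuous F := continuous_norm.comp hcont
  -- `‖h w‖ ≤ (ρ'/(2π(ρ'-ρ))) ∫ F`
  have hstep : ‖h w‖ ≤ ρ' / (2 * π * (ρ' - ρ)) * ∫ θ in (0 : ℝ)..2 * π, F θ := by
    rw [← hC, norm_smul, norm_inv, norm_mul, norm_mul, Complex.norm_ofNat, Complex.norm_real,
      Real.norm_of_nonneg pi_pos.le, Complex.norm_I, mul_one, circleIntegral]
    have hb : ∀ᵐ θ ∂volume, θ ∈ Set.Ioc (0 : ℝ) (2 * π) →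
        ‖deriv (circleMap c ρ') θ • ((circleMap c ρ' θ - w)⁻¹ • h (circleMap c ρ' θ))‖ ≤
          ρ' * (ρ' - ρ)⁻¹ * F θ := by
      refine ae_of_all _ fun θ _ ↦ ?_
      rw [norm_smul, norm_smul, deriv_circleMap, norm_mul, Complex.norm_I, mul_one]
      have e1 : ‖circleMap 0 ρ' θ‖ = ρ' := by
        have := circleMap_mem_sphere' (0 : ℂ) ρ' θ
        rwa [mem_sphere, dist_zero_right, abs_of_pos hρ'0] at this
      rw [e1, mul_assoc]
      refine mul_le_mul_of_nonneg_left ?_ hρ'0.le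
      exact mul_le_mul_of_nonneg_right (norm_inv_circleMap_sub_le hρρ' hw θ) (norm_nonneg _)
    have h1 := intervalIntegral.norm_integral_le_of_norm_le (by positivity) hb
      ((hFc.const_mul _).intervalIntegrable _ _)
    rw [intervalIntegral.integral_const_mul] at h1
    calc (2 * π)⁻¹ * ‖∫ θ in (0 : ℝ)..2 * π,
          deriv (circleMap c ρ') θ • ((circleMap c ρ' θ - w)⁻¹ • h (circleMap c ρ' θ))‖
        ≤ (2 * π)⁻¹ * (ρ' * (ρ' - ρ)⁻¹ * ∫ θ in (0 : ℝ)..2 * π, F θ) := by gcongr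
      _ = ρ' / (2 * π * (ρ' - ρ)) * ∫ θ in (0 : ℝ)..2 * π, F θ := by
          field_simp
  -- Cauchy–Schwarz
  have hCS := sq_integral_le_mul_integral_sq (f := F) (by positivity : (0 : ℝ) ≤ 2 * π)
    (hFc.intervalIntegrable _ _) ((hFc.pow 2).intervalIntegrable _ _)
  rw [sub_zero] at hCS
  calc ‖h w‖ ^ 2 ≤ (ρ' / (2 * π * (ρ' - ρ)) * ∫ θ in (0 : ℝ)..2 * π, F θ) ^ 2 :=
        pow_le_pow_left₀ (norm_nonneg _) hstep 2
    _ = (ρ' / (2 * π * (ρ' - ρ))) ^ 2 * (∫ θ in (0 : ℝ)..2 * π, F θ) ^ 2 := by ring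
    _ ≤ (ρ' / (2 * π * (ρ' - ρ))) ^ 2 * ((2 * π) * ∫ θ in (0 : ℝ)..2 * π, F θ ^ 2) :=
        mul_le_mul_of_nonneg_left hCS (sq_nonneg _)
    _ = ρ' ^ 2 / (2 * π * (ρ' - ρ) ^ 2) * ∫ θ in (0 : ℝ)..2 * π, F θ ^ 2 := by
        field_simp

/-! ### Generic lemmas for the final bookkeeping -/

/-- A function continuous on an open disc `|s − c| < R` and zero-free on the closed disc
`|s − c| ≤ ρ` (`0 ≤ ρ < R`) is zero-free on a larger closed disc `|s − c| ≤ R₁`, `ρ < R₁ < R`.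
[folklore] -/
theorem exists_gt_forall_closedBall_ne_zero {g : ℂ → ℂ} {c : ℂ} {ρ R : ℝ} (hρ : 0 ≤ ρ)
    (hρR : ρ < R) (hg : ContinuousOn g (ball c R)) (h0 : ∀ s ∈ closedBall c ρ, g s ≠ 0) :
    ∃ R₁ : ℝ, ρ < R₁ ∧ R₁ < R ∧ ∀ s ∈ closedBall c R₁, g s ≠ 0 := by
  have hopen : IsOpen (ball c R ∩ g ⁻¹' {0}ᶜ) :=
    hg.isOpen_inter_preimage isOpen_ball isOpen_compl_singleton
  have hsub : closedBall c ρ ⊆ ball c R ∩ g ⁻¹' {0}ᶜ := fun s hs ↦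
    ⟨closedBall_subset_ball hρR hs, h0 s hs⟩
  obtain ⟨δ, hδ, hδsub⟩ := (isCompact_closedBall c ρ).exists_cthickening_subset_open hopen hsub
  set δ' : ℝ := min δ ((R - ρ) / 2) with hδ'
  have hδ'0 : 0 < δ' := lt_min hδ (by linarith)
  refine ⟨ρ + δ', by linarith, ?_, fun s hs ↦ ?_⟩
  · have : δ' ≤ (R - ρ) / 2 := min_le_right _ _
    linarith
  · have hs' : s ∈ cthickening δ (closedBall c ρ) := by
      rw [cthickening_closedBall hδ.le hρ]
      exact closedBall_subset_closedBall (by linarith [min_le_left δ ((R - ρ) / 2)]) hs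
    exact (hδsub hs').2

/-- **A continuity radius uniform in a compact parameter.** If `F` is continuous on `K × X` with
`K` compact and `X` a compact metric space, then for `ε > 0` and `x₀ ∈ X` there is `r > 0` with
`|F(s, x) − F(s, x₀)| < ε` for all `s ∈ K` whenever `dist x x₀ < r`. [folklore] -/
theorem exists_radius_forall_norm_sub_lt {X : Type*} [PseudoMetricSpace X] [CompactSpace X]
    {K : Set ℂ} (hK : IsCompact K) {F : ℂ × X → ℂ} (hF : ContinuousOn F (K ×ˢ univ)) {ε : ℝ}
    (hε : 0 < ε) (x₀ : X) :
    ∃ r : ℝ, 0 < r ∧ ∀ x : X, dist x x₀ < r → ∀ s ∈ K, ‖F (s, x) - F (s, x₀)‖ < ε := by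
  have hU := (hK.prod isCompact_univ).uniformContinuousOn_of_continuous hF
  obtain ⟨r, hr, h⟩ := Metric.uniformContinuousOn_iff.1 hU ε hε
  refine ⟨r, hr, fun x hx s hs ↦ ?_⟩
  have h1 := h (s, x) ⟨hs, mem_univ _⟩ (s, x₀) ⟨hs, mem_univ _⟩ (by
    rw [Prod.dist_eq, dist_self]; exact max_lt hr hx)
  rwa [dist_eq_norm] at h1

/-- **Measure of the good shifts from a test integral.** If `g` is continuous, `g ≤ 1`, and every
`t ∈ (0, T)` with `g(t) > 0` lies in `A`, then `meas(A ∩ [0, T]) ≥ ∫₀ᵀ g`. [folklore] -/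
theorem ofReal_integral_le_volume {g : ℝ → ℝ} (hg : Continuous g) (hg1 : ∀ t, g t ≤ 1) {T : ℝ}
    (hT : 0 ≤ T) {A : Set ℝ} (hA : ∀ t ∈ Ioo 0 T, 0 < g t → t ∈ A) :
    ENNReal.ofReal (∫ t in (0 : ℝ)..T, g t) ≤ volume (A ∩ Icc 0 T) := by
  set G : Set ℝ := g ⁻¹' (Ioi 0) ∩ Ioo 0 T with hG
  have hGm : MeasurableSet G := (hg.measurable measurableSet_Ioi).inter measurableSet_Ioo
  have hGA : G ⊆ A ∩ Icc 0 T := fun t ht ↦ ⟨hA t ht.2 ht.1, Ioo_subset_Icc_self ht.2⟩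
  -- `∫₀ᵀ g ≤ meas G`
  have h1 : ∫ t in (0 : ℝ)..T, g t ≤ ∫ t in Ioo 0 T, G.indicator (fun _ ↦ (1 : ℝ)) t := by
    rw [intervalIntegral.integral_of_le hT, integral_Ioc_eq_integral_Ioo]
    have hi : IntegrableOn (G.indicator fun _ ↦ (1 : ℝ)) (Ioo 0 T) volume :=
      (integrableOn_const (measure_Ioo_lt_top).ne).indicator hGm
    refine setIntegral_mono_on (hg.integrableOn_Icc.mono_set Ioo_subset_Icc_self) hi
      measurableSet_Ioo fun t ht ↦ ?_
    by_cases htG : t ∈ G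
    · rw [indicator_of_mem htG]; exact hg1 t
    · rw [indicator_of_notMem htG]
      by_contra hpos
      exact htG ⟨not_le.1 hpos, ht⟩
  have h2 : ∫ t in Ioo 0 T, G.indicator (fun _ ↦ (1 : ℝ)) t = volume.real G := by
    rw [integral_indicator_const _ hGm, smul_eq_mul, mul_one, measureReal_restrict_apply hGm,
      inter_eq_left.2 (fun t ht ↦ ht.2)]
  calc ENNReal.ofReal (∫ t in (0 : ℝ)..T, g t) ≤ ENNReal.ofReal (volume.real G) :=
        ENNReal.ofReal_le_ofReal (h1.trans_eq h2)
    _ ≤ volume G := ENNReal.ofReal_toReal_le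
    _ ≤ volume (A ∩ Icc 0 T) := measure_mono hGA

/-- **Bookkeeping of the time integrals** (real arithmetic). With `J₁ = T A₁ ≥ T(I₁ − c₁/16)`,
`J₂ ≤ T A₂ ≤ T(s I₁ + d c₁/16)`, `s ≤ d/4`, and `J₃ ≤ (e c₁/4) T`, the combination
`J₁ − J₂/d − J₃/e` is at least `(c₁/4) T`. [folklore] -/
theorem integral_bookkeeping {T I₁ c₁ s d e A₁ A₂ J₁ J₂ J₃ : ℝ} (hT : 0 < T)
    (hc₁ : 0 < c₁) (hI : c₁ ≤ I₁) (hd : 0 < d) (hsd : s ≤ d / 4) (he : 0 < e)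
    (h1 : I₁ - c₁ / 16 < A₁) (h2 : A₂ < s * I₁ + d * c₁ / 16)
    (hJ₁ : J₁ = T * A₁) (hJ₂ : J₂ ≤ T * A₂) (hJ₃ : J₃ ≤ e * c₁ / 4 * T) :
    c₁ / 4 * T ≤ J₁ - J₂ / d - J₃ / e := by
  have hI0 : 0 ≤ I₁ := hc₁.le.trans hI
  -- `J₁ ≥ T I₁ - T c₁/16`
  have hJ₁' : T * I₁ - T * c₁ / 16 ≤ J₁ := by
    rw [hJ₁]; nlinarith [mul_lt_mul_of_pos_left h1 hT]
  -- `J₂/d ≤ T I₁/4 + T c₁/16`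
  have hJ₂' : J₂ / d ≤ T * I₁ / 4 + T * c₁ / 16 := by
    rw [div_le_iff₀ hd]
    have hB : T * A₂ ≤ T * (s * I₁ + d * c₁ / 16) := (mul_lt_mul_of_pos_left h2 hT).le
    have hsI : s * I₁ ≤ d / 4 * I₁ := mul_le_mul_of_nonneg_right hsd hI0
    have : T * (s * I₁) ≤ T * (d / 4 * I₁) := mul_le_mul_of_nonneg_left hsI hT.le
    nlinarith
  -- `J₃/e ≤ T c₁/4`
  have hJ₃' : J₃ / e ≤ T * c₁ / 4 := by
    rw [div_le_iff₀ he]; nlinarith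
  have hTI : T * c₁ ≤ T * I₁ := mul_le_mul_of_nonneg_left hI hT.le
  nlinarith

end VoroninTools

end Literature.NumberTheory.LFunctions
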